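/-
COR-CM / cell hodgecm-mathlib (D-0151) — GS programme of the `stub_S34` residual of crux `HLiu418` (24832), node GS-7c at the RECORD
level: the kernel junction GS-7a ∘ GS-7c.  Seat prover-hodgecm-mathlib-A-p18-g6-0 (GS-7c first refusal, A-plan2 GO 20:55:08Z /
21:17:45Z; A-plan1 21:17:31Z «announce it and it is yours»).  THEOREMS ONLY: no definition, no instance, no named fact, nothing
asserted; every landed file untouched.  FRAMING: HC_CM is NOT proved; nothing here discharges a printed-citation binder by itself.
-/
import Summits.HodgeConjecture.CorCM.B01.Transposition.HComp.PiecesOfRecordFieldRange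
import Summits.HodgeConjecture.CorCM.B01.Transposition.HComp.HonestP5Of
import Literature.AlgebraicGeometry.ShimuraVarieties.UnitaryBallH1RestrictionSubfieldCode
import HarnessLib

/-!
# The pieces of Deligne's canonical model DETECT `H¹`: III-8′ read on every E-pinned piece, in the record's own currency

For a record system `S : RecordSystem L H τ T hT K₀` of Deligne's canonical model of `Sh(U(H), 𝔹²)` ([Deligne1979ShimuraVarieties]
2.2.5; tree `UnitaryShimuraCanonicalModel`) and a small level `K`, ★ GS-7a `HComp.RecordSystem.exists_pieces_fieldRange` presents the
complex fibre `(M_K)_τ` as a coproduct of compact ball quotients `X_q`, `q ∈ Ξ_K`, each with a ball datum `B q` PINNED to the code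
field: `(B q).E = τ(L)`, `(B q).Hℂ = H^τ`, `τ₁((B q).Γ) = τ(Γ_H(g_q K g_q⁻¹))`.  ★ GS-7c
`UnitaryBallUniformisationDatum.MR92Prop6Source.exists_line_detecting_of_forall` reads the named fact III-8′ `MR92Prop6Source`
([Liu2021] proof of Thm. 4.15, l. 2212 / fn. 9) over such a subfield code.  This file composes the two (the opaque subfield
`(B q).E` never leaves the proof; the read-outs ★ `ballDatum_exists_ringEquiv_coe_eq_of_E_eq` /
`ballDatum_H_eq_map_ringEquiv_of_Hℂ_eq` / `ballDatum_Γ_eq_map_ringEquiv_of_map_eq` feed GS-7c's hypotheses BY NAME):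

* `RecordSystem.exists_pieces_detectingLine` — under the DATUM-UNIVERSAL III-8′ binder
  `(hMR : ∀ {X} (D : UnitaryBallUniformisationDatum 2 X), D.MR92Prop6Source)` (the head-binder shape of the `stub_S34` closer), the ★
  GS-7a presentation TOGETHER WITH, on every piece `q`, the detecting `L`-line: every `c ≠ 0` in `H¹(X_q(ℂ); ℂ)` has a totally positive
  definite `L`-line `W₀ ⊆ L³` for `H` (`finrank 1`) such that every uniformised special curve `(Y, D₁, φ, M)` satisfying the four
  compatibility clauses READ ON `(H, τ, Γ_H(g_q K g_q⁻¹), W₀)` detects `c` (`φ(ℂ)^* c ≠ 0`);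
* `exists_pieces_detectingLine_recordOf` — the same for THE chosen system `Model.recordOf h V h4` of the tree's hermitian space
  `V : HermSpace3 F ι₁` below the threshold `K3 V` (hypotheses fed by `V.isHermitian`, `HermSpace3.anisotropic_of_four_le`,
  `V.posDef_of_ne`, `torsionFree_arithmeticLevel_conj_K3`): `W₀ ⊆ F³` for `V.Hm`, the input of the frame engine ★
  `exists_frame_formCongr_eq_finSum_of_isTotallyPositive_of_isHermitian` over `F` in the GS-7 closer.

This is §0 of the GS-7 clause-(1) closer of A-plan1's lead KEY (7c, v3): ONE name per level.  0 hypothesis binders of Prop-valued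
named facts beyond `hMR` (III-8′) and `h : exists_recordSystem` ([Deligne1979] 2.2.5), both carried by the caller.

References: [Deligne1979ShimuraVarieties] P. Deligne, *Variétés de Shimura* (1979), 2.1.2, 2.2.5; [Milne2005ShimuraVarieties] J. S.
Milne, *Introduction to Shimura varieties* (2005), Lemma 5.13; [Liu2021] Y. Liu, Camb. J. Math. 9 (2021), proof of Thm. 4.15,
l. 2207, l. 2212 with fn. 9; [MurtyRamakrishnan1992] V. K. Murty, D. Ramakrishnan, CRM 1992, Prop. 6 (locator from [Liu2021],
unverified; not held); [BergeronMillsonMoeglin2016Balls] N. Bergeron, J. Millson, C. Moeglin, Acta Math. 216 (2016), Part 2 §§1.1–1.4, 3.1.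
-/

set_option autoImplicit false

noncomputable section

open scoped Matrix Topology ComplexOrder
open Set Function MulAction Matrix NumberField CategoryTheory CategoryTheory.Limits AlgebraicGeometry Opposite
open Literature.Geometry.ComplexHyperbolic
open Literature.Geometry.ComplexHyperbolic.BallModel (U21 Ball proj lift mat x₀)
open Literature.NumberTheory.Automorphic
open Literature.NumberTheory.Automorphic.UnitaryGroup
open Literature.NumberTheory.Automorphic.ShimuraDissection (CosetSpace)
open Literature.AlgebraicGeometry.ShimuraVarieties (negCone UnitaryBallUniformisationDatum IsCongruenceSubgroup IsTotallyPositive)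
open Literature.AlgebraicGeometry.ShimuraVarieties.UnitaryCanonicalModel (Record RecordSystem)
open Literature.AlgebraicGeometry.Motives (SchemeOver ComplexPoints AlgPoints IsSmoothProjective IsProjectiveOver baseChangeHom)
open Literature.AlgebraicGeometry.HodgeTheory (complexBetti)
open Literature.AlgebraicTopology.SingularHomology (singularCohomology)
open Literature.NumberTheory.Automorphic.Liu2021.AppendixC (C5.OpenCompactSubgroup C5.SmallLevel)

namespace Summit.HodgeConjecture.CorCM.HComp

/-! ## 1. Any record system: the E-pinned pieces with their detecting lines -/

/-- **The E-pinned pieces of `(M_K)_τ` DETECT `H¹` through compatible special curves read on `L`-data.**  For a record system `S` of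
Deligne's canonical model (hypotheses as in ★ `RecordSystem.exists_pieces_fieldRange`) and the datum-universal III-8′ binder `hMR`, there
is a pieces presentation `(g, X, ι, B)` of `(M_K)_τ` with `(B q).E = τ(L)`, `(B q).Hℂ = H^τ`, `τ₁((B q).Γ) = τ(Γ_H(g_q K g_q⁻¹))` and the
uniformisation clause, such that on every piece `q` every non-zero `c ∈ H¹(X_q(ℂ); ℂ)` admits a totally positive definite `L`-LINE `W₀ ⊆ L³`
for `H` (and the CM conjugation of `L`), of `finrank 1`, detected by every uniformised special curve `(Y, D₁, φ, M)` whose compatibility is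
read on `(H, τ, Γ_H(g_q K g_q⁻¹), W₀)`: `Mᴴ·H^τ·M = D₁.Hℂ`, `⟪τ∘v, M u⟫ = 0` (`v ∈ W₀`), `Γ₁` restricted from `τ(Γ_H(g_q K g_q⁻¹))` along `M`,
`φ(ℂ) ∘ unif₁ = unif_q ∘ M` — then `φ(ℂ)^* c ≠ 0`.  (★ GS-7a + ★ `ballDatum_*` read-outs + ★ GS-7c `exists_line_detecting_of_forall`.)
[cite: Liu2021, proof of Thm. 4.15, l. 2212 and footnote 9; l. 2207] [cite: Deligne1979ShimuraVarieties, §2.1.2 and 2.2.5]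
[cite: Milne2005ShimuraVarieties, Lemma 5.13 p. 57] [cite: MurtyRamakrishnan1992, Prop. 6 (locator unverified)] -/
theorem RecordSystem.exists_pieces_detectingLine
    {L : Type} [Field L] [NumberField L] [IsCMField L] (H : Matrix (Fin 3) (Fin 3) L)
    (τ : L →+* ℂ) (T : GL (Fin 3) ℂ) (hT : formCongr (starRingEnd ℂ) T (H.map τ) = BallModel.J)
    {K₀ : C5.OpenCompactSubgroup ↥(finAdelic (↥(maximalRealSubfield L)) L (IsCMField.complexConj L) 3 H)}
    (hH : ∀ i j, cmConjRingHom L (H i j) = H j i)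
    (hanis : ∀ v : Fin 3 → L, Literature.AlgebraicGeometry.ShimuraVarieties.hermForm (cmConjRingHom L) H v v = 0 → v = 0)
    (hpos : ∀ τ' : L →+* ℂ, InfinitePlace.mk τ' ≠ InfinitePlace.mk τ → (H.map τ').PosDef)
    (htf : ∀ g : finAdelic (↥(maximalRealSubfield L)) L (IsCMField.complexConj L) 3 H,
      ∀ γ ∈ arithmeticLevel (↥(maximalRealSubfield L)) L (IsCMField.complexConj L) 3 H
        (K₀.1.map (MulAut.conj g).toMonoidHom), IsOfFinOrder γ → γ = 1)
    (S : RecordSystem L H τ T hT K₀) (K : C5.SmallLevel K₀)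
    (hMR : ∀ {X : SchemeOver ℂ} (D : UnitaryBallUniformisationDatum 2 X), D.MR92Prop6Source) :
    letI : Algebra L ℂ := τ.toAlgebra
    ∃ (g : orbitRel.Quotient (rational (↥(maximalRealSubfield L)) L (IsCMField.complexConj L) 3 H)
          (CosetSpace (rationalToFinAdelic (↥(maximalRealSubfield L)) L (IsCMField.complexConj L) 3 H) K.1.1) →
        finAdelic (↥(maximalRealSubfield L)) L (IsCMField.complexConj L) 3 H)
      (_ : ∀ q, Quotient.mk'' (CosetSpace.pt (rationalToFinAdelic _ L _ 3 H) K.1.1 (g q)) = q)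
      (X : orbitRel.Quotient (rational (↥(maximalRealSubfield L)) L (IsCMField.complexConj L) 3 H)
          (CosetSpace (rationalToFinAdelic (↥(maximalRealSubfield L)) L (IsCMField.complexConj L) 3 H) K.1.1) →
        SchemeOver ℂ)
      (ι : ∀ q, X q ⟶ (baseChangeHom τ).obj (S.M.obj K))
      (_ : IsColimit (Cofan.mk ((baseChangeHom τ).obj (S.M.obj K)) ι))
      (B : ∀ q, UnitaryBallUniformisationDatum 2 (X q)),
      ∀ q, ((B q).E = τ.fieldRange ∧ (B q).Hℂ = H.map τ ∧
        (B q).Γ.map (Matrix.GeneralLinearGroup.map ((B q).τ₁ : ↥(B q).E →+* ℂ)) =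
          (arithmeticLevel (↥(maximalRealSubfield L)) L (IsCMField.complexConj L) 3 H
            (K.1.1.map (MulAut.conj (g q)).toMonoidHom)).map (Matrix.GeneralLinearGroup.map τ) ∧
        ∀ x : Ball, AlgPoints.map (ι q) ((B q).unif ((T : Matrix (Fin 3) (Fin 3) ℂ) *ᵥ BallModel.lift x)) =
          AlgPoints.baseChangeEquiv τ (S.M.obj K) ((S.pts K).symm (ShimuraSet.mk L H τ T hT K.1.1 x (g q)))) ∧
        ∀ c : complexBetti (X q) 1, c ≠ 0 →
          ∃ W₀ : Submodule L (Fin 3 → L),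
            IsTotallyPositive (IsCMField.complexConj L).toRingEquiv.toRingHom H W₀ ∧ Module.finrank L W₀ = 1 ∧
              ∀ (Y : SchemeOver ℂ) (D₁ : UnitaryBallUniformisationDatum 1 Y) (φ : Y ⟶ X q) (M : Matrix (Fin 3) (Fin 2) ℂ),
                M.conjTranspose * H.map τ * M = D₁.Hℂ →
                (∀ v ∈ W₀, ∀ u : Fin 2 → ℂ, Literature.AlgebraicGeometry.ShimuraVarieties.hermForm (starRingEnd ℂ) (H.map τ) (⇑τ ∘ v) (M.mulVec u) = 0) →
                (∀ γ₁ ∈ D₁.Γ, ∃ γ ∈ arithmeticLevel (↥(maximalRealSubfield L)) L (IsCMField.complexConj L) 3 H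
                    (K.1.1.map (MulAut.conj (g q)).toMonoidHom),
                  (γ : Matrix (Fin 3) (Fin 3) L).map τ * M = M * ((γ₁ : Matrix (Fin 2) (Fin 2) ↥D₁.E)).map D₁.E.subtype) →
                (∀ v ∈ negCone D₁.Hℂ, AlgPoints.map φ (D₁.unif v) = (B q).unif (M.mulVec v)) →
                  singularCohomology.map ℂ ℂ (AlgPoints.mapContinuous (L := ℂ) φ) 1 c ≠ 0 := by
  letI : Algebra L ℂ := τ.toAlgebra
  obtain ⟨g, hg, X, ι, hcol, B, hB⟩ := RecordSystem.exists_pieces_fieldRange L H τ T hT hH hanis hpos htf S K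
  refine ⟨g, hg, X, ι, hcol, B, fun q => ⟨hB q, fun c hc => ?_⟩⟩
  -- the subfield code of the piece `q` and its two read-outs
  obtain ⟨e, he⟩ := ballDatum_exists_ringEquiv_coe_eq_of_E_eq τ (B q) (hB q).1
  have hHq := ballDatum_H_eq_map_ringEquiv_of_Hℂ_eq τ (B q) e he (hB q).2.1
  have hΓq := ballDatum_Γ_eq_map_ringEquiv_of_map_eq τ (B q) e he (hB q).2.2.1
  exact UnitaryBallUniformisationDatum.MR92Prop6Source.exists_line_detecting_of_forall τ (B q) e he hHq hΓq hMR c hc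

/-! ## 2. The chosen system of the tree's hermitian space `V` below `K3 V` -/

/-- **The E-pinned pieces of `V`'s canonical model detect `H¹`, at every small level below `K3 V`** — `RecordSystem.exists_pieces_detectingLine`
at `S := Model.recordOf h V h4`, with the record hypotheses fed by the face's own data: `V.isHermitian`, ★ `HermSpace3.anisotropic_of_four_le V h4`,
`V.posDef_of_ne`, ★ `torsionFree_arithmeticLevel_conj_K3 V`.  The detecting lines are `F`-lines `W₀ ⊆ F³`, totally positive definite for `V.Hm`
and the CM conjugation of `F` — the input of ★ `exists_frame_formCongr_eq_finSum_of_isTotallyPositive_of_isHermitian` over `F`.  CONDITIONAL on the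
named facts `h : exists_recordSystem` ([Deligne1979] 2.2.5) and `hMR` (III-8′), both carried by the caller; HC_CM is NOT proved.
[cite: Liu2021, proof of Thm. 4.15, l. 2212 and footnote 9; App. C l. 4599] [cite: Deligne1979ShimuraVarieties, 2.2.5 and Cor. 2.7.21]
[cite: MurtyRamakrishnan1992, Prop. 6 (locator unverified)] -/
theorem exists_pieces_detectingLine_recordOf {F : CMField} {ι₁ : F →+* ℂ}
    (h : Literature.AlgebraicGeometry.ShimuraVarieties.UnitaryCanonicalModel.exists_recordSystem)
    (V : HermSpace3 F ι₁) (h4 : 4 ≤ Module.finrank ℚ F)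
    (hMR : ∀ {X : SchemeOver ℂ} (D : UnitaryBallUniformisationDatum 2 X), D.MR92Prop6Source)
    (K : C5.SmallLevel (K3 V)) :
    letI : Algebra F ℂ := ι₁.toAlgebra
    ∃ (g : orbitRel.Quotient (rational (↥(maximalRealSubfield F)) F (IsCMField.complexConj F) 3 V.Hm)
          (CosetSpace (rationalToFinAdelic (↥(maximalRealSubfield F)) F (IsCMField.complexConj F) 3 V.Hm) K.1.1) →
        finAdelic (↥(maximalRealSubfield F)) F (IsCMField.complexConj F) 3 V.Hm)
      (_ : ∀ q, Quotient.mk'' (CosetSpace.pt (rationalToFinAdelic _ F _ 3 V.Hm) K.1.1 (g q)) = q)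
      (X : orbitRel.Quotient (rational (↥(maximalRealSubfield F)) F (IsCMField.complexConj F) 3 V.Hm)
          (CosetSpace (rationalToFinAdelic (↥(maximalRealSubfield F)) F (IsCMField.complexConj F) 3 V.Hm) K.1.1) →
        SchemeOver ℂ)
      (ι : ∀ q, X q ⟶ (baseChangeHom ι₁).obj ((Model.recordOf h V h4).M.obj K))
      (_ : IsColimit (Cofan.mk ((baseChangeHom ι₁).obj ((Model.recordOf h V h4).M.obj K)) ι))
      (B : ∀ q, UnitaryBallUniformisationDatum 2 (X q)),
      ∀ q, ((B q).E = ι₁.fieldRange ∧ (B q).Hℂ = V.Hm.map ι₁ ∧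
        (B q).Γ.map (Matrix.GeneralLinearGroup.map ((B q).τ₁ : ↥(B q).E →+* ℂ)) =
          (arithmeticLevel (↥(maximalRealSubfield F)) F (IsCMField.complexConj F) 3 V.Hm
            (K.1.1.map (MulAut.conj (g q)).toMonoidHom)).map (Matrix.GeneralLinearGroup.map ι₁) ∧
        ∀ x : Ball, AlgPoints.map (ι q) ((B q).unif ((Model.frameOf V : Matrix (Fin 3) (Fin 3) ℂ) *ᵥ BallModel.lift x)) =
          AlgPoints.baseChangeEquiv ι₁ ((Model.recordOf h V h4).M.obj K)
            (((Model.recordOf h V h4).pts K).symm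
              (ShimuraSet.mk F V.Hm ι₁ (Model.frameOf V) (Model.formCongr_frameOf V) K.1.1 x (g q)))) ∧
        ∀ c : complexBetti (X q) 1, c ≠ 0 →
          ∃ W₀ : Submodule F (Fin 3 → F),
            IsTotallyPositive (IsCMField.complexConj F).toRingEquiv.toRingHom V.Hm W₀ ∧ Module.finrank F W₀ = 1 ∧
              ∀ (Y : SchemeOver ℂ) (D₁ : UnitaryBallUniformisationDatum 1 Y) (φ : Y ⟶ X q) (M : Matrix (Fin 3) (Fin 2) ℂ),
                M.conjTranspose * V.Hm.map ι₁ * M = D₁.Hℂ →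
                (∀ v ∈ W₀, ∀ u : Fin 2 → ℂ, Literature.AlgebraicGeometry.ShimuraVarieties.hermForm (starRingEnd ℂ) (V.Hm.map ι₁) (⇑ι₁ ∘ v) (M.mulVec u) = 0) →
                (∀ γ₁ ∈ D₁.Γ, ∃ γ ∈ arithmeticLevel (↥(maximalRealSubfield F)) F (IsCMField.complexConj F) 3 V.Hm
                    (K.1.1.map (MulAut.conj (g q)).toMonoidHom),
                  (γ : Matrix (Fin 3) (Fin 3) F).map ι₁ * M = M * ((γ₁ : Matrix (Fin 2) (Fin 2) ↥D₁.E)).map D₁.E.subtype) →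
                (∀ v ∈ negCone D₁.Hℂ, AlgPoints.map φ (D₁.unif v) = (B q).unif (M.mulVec v)) →
                  singularCohomology.map ℂ ℂ (AlgPoints.mapContinuous (L := ℂ) φ) 1 c ≠ 0 :=
  RecordSystem.exists_pieces_detectingLine V.Hm ι₁ (Model.frameOf V) (Model.formCongr_frameOf V) V.isHermitian
    (HermSpace3.anisotropic_of_four_le V h4) V.posDef_of_ne (torsionFree_arithmeticLevel_conj_K3 V)
    (Model.recordOf h V h4) K hMR

end Summit.HodgeConjecture.CorCM.HComp

end
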